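import Literature.MathematicalPhysics.KineticTheory.HardSphereEuler
import Literature.Analysis.FunctionSpaces.FlatTorus
import HarnessLib

/-!
# Crux `ConeLocalisation` (stmt-AtomisticToContinuum-12504) — ideator 2, round 1: first lemmas of the idea cards

Typed (`def … : Prop`, nothing asserted, nothing proved) first checkable statements of the two crux idea
cards filed by planner-cruxidea-stmt-AtomisticToContinuum-12504-2-0:

* card `zoomed-bubble-transplant`  — `BubbleAtScale` (the comparison Euler solution at flattening scale `r`
  with an `r`-INDEPENDENT `C¹` guard, to be proved by hyperbolic zoom to unit scale) and the statics spine
  `FugacityMatchedComparison` (activity-level flattening + equal fugacity scale + commensurate particle number);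
* card `scale-invariant-agmon-bootstrap` — `HomogeneousAgmonT3` (the scale-invariant interpolation
  inequality for ball-supported deviations) and `AprioriC1AtScale` (the a-priori form of the same `C¹` guard,
  proved at scale `r` without dilations).

Everything is stated over existing declarations of `HardSphereEuler.lean`, `TorusCalculus.lean`,
`FlatTorus.lean`, `HardSpherePhaseSpace.lean`; see the cards for the role of each statement.
-/

namespace Summit.AtomisticToContinuum.HydrodynamicLimit.Cruxes.ConeLocalisation.IdeatorTwo

open scoped BigOperators Topology
open Filter Set MeasureTheory
open Literature.MathematicalPhysics.KineticTheory Literature.Analysis.FluidPDE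
  Literature.Analysis.FunctionSpaces

noncomputable section

/-- Pointwise `C⁰…C³` deviation bounds of a scalar field from a constant, at flattening scale `r` with
slope `κ`: `|f - c| ≤ κ r`, `|∂f| ≤ κ`, `|∂²f| ≤ κ/r`, `|∂³f| ≤ κ/r²` (the bounds the flattened
time-zero slice `ψ·f + (1-ψ)·f(x₀)` inherits from `|∂ᵏf| ≤ M`, `k ≤ 3`, with `κ = C·M`). -/
def ScaleDeviation (f : T3 → ℝ) (c r κ : ℝ) : Prop :=
  ∀ x, |f x - c| ≤ κ * r ∧ ∀ i j k : Fin 3, |Torus.partialDeriv i f x| ≤ κ ∧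
    |Torus.partialDeriv i (Torus.partialDeriv j f) x| ≤ κ / r ∧
    |Torus.partialDeriv i (Torus.partialDeriv j (Torus.partialDeriv k f)) x| ≤ κ / r ^ 2

/-- The same for a vector field. -/
def ScaleDeviationV (f : T3 → V3) (c : V3) (r κ : ℝ) : Prop :=
  ∀ x, ‖f x - c‖ ≤ κ * r ∧ ∀ i j k : Fin 3, ‖Torus.partialDeriv i f x‖ ≤ κ ∧
    ‖Torus.partialDeriv i (Torus.partialDeriv j f) x‖ ≤ κ / r ∧
    ‖Torus.partialDeriv i (Torus.partialDeriv j (Torus.partialDeriv k f)) x‖ ≤ κ / r ^ 2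

/-- **First lemma of card `zoomed-bubble-transplant` — the bubble at scale `r`.** There is a packing
threshold `η₁` and, for every guard level `M`, a zoomed life span `s₀`, a smallness `ε₀` and a constant
`C` such that: for every reduced diameter `σ > 0`, every constant state `(ρ̄, ū, θ̄)` in the guarded box,
every scale `0 < r ≤ 1/4` and slope `κ ≥ 0` with `κ r ≤ ε₀`, every centre `x₀` and all smooth data that
EQUAL the constant state outside `B(x₀, r/4)` and deviate from it at scale `r` with slope `κ`, the
hard-sphere Euler system has a classical solution on `[0, r s₀)` issued from these data whose deviation
stays `≤ Cκr` in `C⁰` and `≤ Cκ` in `C¹` — INDEPENDENTLY OF `r` — and which equals the constant state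
outside `B(x₀, r/2)` at all times. (Proof device: hyperbolic zoom `(t, x) ↦ (t/r, (x - x₀)/r)` of the
compactly supported bubble to the unit torus, where the data are an `O(κr)`-small `C³` perturbation of a
constant; derivative-only level-`1..3` energies `CompressibleEuler.levelEnergy_step_uniform` + Sobolev;
`hsEuler_localExistence_holds`, `hsEuler_continuation_holds`, `IsHardSphereEulerSolution.exists_of_apriori`;
compact support kept by `LightConeInLawSketch.DoD.cone_unique_of_smooth_eos` against the constant
solution; un-zoom and extend by the constant.) -/
def BubbleAtScale : Prop :=
  ∃ η₁ : ℝ, 0 < η₁ ∧ ∀ M : ℝ, 0 < M → ∃ s₀ : ℝ, 0 < s₀ ∧ ∃ ε₀ : ℝ, 0 < ε₀ ∧ ∃ C : ℝ, 0 < C ∧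
  ∀ σ : ℝ, 0 < σ → ∀ (ρbar θbar : ℝ) (ubar : V3),
    M⁻¹ ≤ ρbar → ρbar ≤ M → ρbar * σ ^ 3 ≤ η₁ → M⁻¹ ≤ θbar → θbar ≤ M → ‖ubar‖ ≤ M →
  ∀ (r κ : ℝ), 0 < r → r ≤ 1 / 4 → 0 ≤ κ → κ * r ≤ ε₀ →
  ∀ (x₀ : T3) (ρ₀ θ₀ : T3 → ℝ) (u₀ : T3 → V3),
    Torus.IsSmooth ρ₀ → Torus.IsSmooth θ₀ → Torus.IsSmooth u₀ →
    (∀ x, r / 4 ≤ Torus.euclidDist x x₀ → ρ₀ x = ρbar ∧ θ₀ x = θbar ∧ u₀ x = ubar) →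
    ScaleDeviation ρ₀ ρbar r κ → ScaleDeviation θ₀ θbar r κ → ScaleDeviationV u₀ ubar r κ →
  ∃ (ρ θ : ℝ → T3 → ℝ) (u : ℝ → T3 → V3),
    IsHardSphereEulerSolution σ (r * s₀) ρ u θ ∧ ρ 0 = ρ₀ ∧ θ 0 = θ₀ ∧ u 0 = u₀ ∧
    (∀ s ∈ Set.Ico 0 (r * s₀), ∀ x, |ρ s x - ρbar| ≤ C * κ * r ∧ |θ s x - θbar| ≤ C * κ * r ∧
      ‖u s x - ubar‖ ≤ C * κ * r ∧ ∀ i : Fin 3, |Torus.partialDeriv i (ρ s) x| ≤ C * κ ∧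
      ‖Torus.partialDeriv i (u s) x‖ ≤ C * κ ∧ |Torus.partialDeriv i (θ s) x| ≤ C * κ) ∧
    (∀ s ∈ Set.Ico 0 (r * s₀), ∀ x, r / 2 ≤ Torus.euclidDist x x₀ →
      ρ s x = ρbar ∧ θ s x = θbar ∧ u s x = ubar)

/-- The universal activity map of the dilute hard-sphere gas in REDUCED density,
`Ψ(η) = η · exp(f_ex(η) + η f_ex′(η))` (so that the inverted activity of
`NearConstantShortTimeHL.staticLLN_explicit` reads `a₀ = e^{c} σ⁻³ Ψ(ρa σ³)`). -/
def reducedActivity (η : ℝ) : ℝ :=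
  η * Real.exp (hsExcessFreeEnergy η + η * deriv hsExcessFreeEnergy η)

/-- **Statics spine of card `zoomed-bubble-transplant` — the fugacity-matched comparison gas.** For
continuous positive profiles `(a₀, u₀, θ₀)` there is `σ₀ > 0` such that for `0 < σ < σ₀`, every
continuous cutoff `0 ≤ ψ ≤ 1` and every centre `x₀`, the ACTIVITY-flattened profile
`a₂ = ψ a₀ + (1 - ψ) a₀(x₀)` (likewise `u₂`, `θ₂`; all `σ`-free) admits a comparison reduced diameter
`σ₂ > 0` such that: gas 1 (`N+1` spheres, `localGibbsLaw σ a₀ u₀ θ₀`) and gas 2 (the COMMENSURATE family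
`n₂ N = ⌈(σ₂/σ)³ (N+1)⌉₊` of spheres of the SAME diameter `hsDiameter σ N`, canonical local Gibbs law of
`(a₂, u₂, θ₂)`) both satisfy the static law of large numbers at time `0`, towards unit-mass densities
`ρ₁`, `ρ₂` whose REDUCED densities agree exactly where `ψ = 1`: `ρ₁ σ³ = ρ₂ σ₂³`; moreover `ρ₂` is
pinned to the same fugacity scale as `ρ₁` (`a₂ = e^{c} σ₂⁻³ Ψ(ρ₂σ₂³)` with gas 1's constant `c`), and
`σ₂³/σ³ ∈ [inf a₀/(2 sup a₀), 2 sup a₀/inf a₀]` (from `η ≤ Ψ(η) ≤ η e^{h(η₀)}` on the band, `h ≥ 0`). (Proof: `staticLLN_explicit` for both families, strict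
monotonicity of the total reduced mass `c ↦ ∫ Ψ⁻¹(e^{-c} a₂)` and the choice
`σ₂³ := ∫ Ψ⁻¹(e^{-c₁} a₂)`; `Ψ⁻¹` is never evaluated outside `Ψ([min η₁, max η₁])`.) -/
def FugacityMatchedComparison : Prop :=
  ∀ (a₀ θ₀ : T3 → ℝ) (u₀ : T3 → V3), Continuous a₀ → Continuous θ₀ → Continuous u₀ →
    (∀ x, 0 < a₀ x) → (∀ x, 0 < θ₀ x) →
  ∃ σ₀ : ℝ, 0 < σ₀ ∧ ∀ σ : ℝ, 0 < σ → σ < σ₀ →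
  ∀ (ψ : T3 → ℝ), Continuous ψ → (∀ x, 0 ≤ ψ x ∧ ψ x ≤ 1) → ∀ x₀ : T3,
  let a₂ : T3 → ℝ := fun x => ψ x * a₀ x + (1 - ψ x) * a₀ x₀
  let u₂ : T3 → V3 := fun x => ψ x • u₀ x + (1 - ψ x) • u₀ x₀
  let θ₂ : T3 → ℝ := fun x => ψ x * θ₀ x + (1 - ψ x) * θ₀ x₀
  ∃ σ₂ : ℝ, 0 < σ₂ ∧
    sInf (Set.range a₀) / sSup (Set.range a₀) / 2 * σ ^ 3 ≤ σ₂ ^ 3 ∧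
    σ₂ ^ 3 ≤ 2 * (sSup (Set.range a₀) / sInf (Set.range a₀)) * σ ^ 3 ∧
  ∃ (ρ₁ ρ₂ : T3 → ℝ) (c : ℝ), Continuous ρ₁ ∧ Continuous ρ₂ ∧ (∀ x, 0 < ρ₁ x ∧ 0 < ρ₂ x) ∧
    (∫ x, ρ₁ x) = 1 ∧ (∫ x, ρ₂ x) = 1 ∧
    (∀ x, a₀ x = Real.exp c * (σ ^ 3)⁻¹ * reducedActivity (ρ₁ x * σ ^ 3)) ∧
    (∀ x, a₂ x = Real.exp c * (σ₂ ^ 3)⁻¹ * reducedActivity (ρ₂ x * σ₂ ^ 3)) ∧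
    (∀ x, ψ x = 1 → ρ₁ x * σ ^ 3 = ρ₂ x * σ₂ ^ 3) ∧
    (∀ Φ : (N : ℕ) → HardSphereFlow (Torus.geometry (Fin 3)) (hsDiameter σ N) (N + 1),
      TendstoHydroFieldsAt (fun N => localGibbsLaw σ a₀ u₀ θ₀ N (Φ N)) Φ
        (fun _ => ρ₁) (fun _ => u₀) (fun _ => θ₀) 0) ∧
    (let n₂ : ℕ → ℕ := fun N => ⌈(σ₂ / σ) ^ 3 * ((N + 1 : ℕ) : ℝ)⌉₊
     ∀ Φ₂ : (N : ℕ) → HardSphereFlow (Torus.geometry (Fin 3)) (hsDiameter σ N) (n₂ N),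
     let P₂ : (N : ℕ) → Measure (Config (n₂ N) (Fin 3) T3) := fun N =>
       particleLaw (Φ₂ N) (canonicalDensity (Torus.geometry (Fin 3)) (hsDiameter σ N) (n₂ N)
         (localGibbsProfile a₂ u₂ θ₂))
     (∀ N, IsProbabilityMeasure (P₂ N)) ∧
     ∀ χ : T3 → ℝ, Continuous χ → ∀ δ : ℝ, 0 < δ →
      Tendsto (fun N => P₂ N {z | δ < |empiricalDensityField ((Φ₂ N).flow 0 z) χ - ∫ x, χ x * ρ₂ x|})
        atTop (nhds 0) ∧
      Tendsto (fun N => P₂ N {z | δ < ‖empiricalMomentumField ((Φ₂ N).flow 0 z) χ -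
        ∫ x, (χ x * ρ₂ x) • u₂ x‖}) atTop (nhds 0) ∧
      Tendsto (fun N => P₂ N {z | δ < |empiricalEnergyField ((Φ₂ N).flow 0 z) χ -
        ∫ x, χ x * totalEnergyDensity (ρ₂ x) (u₂ x) (θ₂ x)|}) atTop (nhds 0))

/-- **First lemma of card `scale-invariant-agmon-bootstrap` — the homogeneous Agmon inequality on `𝕋³`
for ball-supported deviations.** There is an absolute constant `C` such that every smooth `f : 𝕋³ → ℝ`
that is constant outside a ball of radius `1/4` obeys
`‖∂f‖_∞⁸ ≤ C · (Σᵢ ∫ |∂ᵢ f|²) · (Σ_{ijk} ∫ |∂ᵢ∂ⱼ∂ₖ f|²)³`, i.e. `‖∇f‖_∞ ≤ C ‖∇f‖₂^{1/4} ‖∇³f‖₂^{3/4}`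
— the SCALE-INVARIANT read-out replacing the inhomogeneous torus Sobolev embedding (which loses a
factor `r^{-1/2}` at scale `r`). (Whole-space inequality for the compactly supported lift; Fourier split
or the elementary kernel proof.) -/
def HomogeneousAgmonT3 : Prop :=
  ∃ C : ℝ, 0 < C ∧ ∀ (f : T3 → ℝ) (x₀ : T3) (b : ℝ), Torus.IsSmooth f →
    (∀ x, 1 / 4 ≤ Torus.euclidDist x x₀ → f x = b) →
    ∀ (x : T3) (i : Fin 3), |Torus.partialDeriv i f x| ^ 8 ≤
      C * (∑ i : Fin 3, ∫ y, Torus.partialDeriv i f y ^ 2) *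
        (∑ i : Fin 3, ∑ j : Fin 3, ∑ k : Fin 3,
          ∫ y, Torus.partialDeriv i (Torus.partialDeriv j (Torus.partialDeriv k f)) y ^ 2) ^ 3

/-- **Second statement of card `scale-invariant-agmon-bootstrap` — the a-priori `C¹` guard at scale `r`,
WITHOUT dilations.** Same thresholds as `BubbleAtScale`, but as an a-priori estimate along any classical
solution on a horizon `T ≤ r s₀` issued from scale-`r` bubble data: the deviation stays `≤ Cκr` in `C⁰`
and `≤ Cκ` in `C¹`. (Proof device: LEVEL-SEPARATED energies `E₁, E₂, E₃` of the deviation, each closed by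
`CompressibleEuler.levelEnergy_step_uniform` under the bootstrap assumption `C¹ ≤ 2Cκ`, and the
scale-invariant read-out `HomogeneousAgmonT3`: `‖∇U‖_∞ ≲ E₁^{1/8} E₃^{3/8} = O(κ)` because
`E₁(0) ≲ κ²r³`, `E₃(0) ≲ κ²/r`; existence on `[0, r s₀)` then follows from `hsEuler_localExistence_holds`,
`hsEuler_continuation_holds` and `IsHardSphereEulerSolution.exists_of_apriori`.) -/
def AprioriC1AtScale : Prop :=
  ∃ η₁ : ℝ, 0 < η₁ ∧ ∀ M : ℝ, 0 < M → ∃ s₀ : ℝ, 0 < s₀ ∧ ∃ ε₀ : ℝ, 0 < ε₀ ∧ ∃ C : ℝ, 0 < C ∧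
  ∀ σ : ℝ, 0 < σ → ∀ (ρbar θbar : ℝ) (ubar : V3),
    M⁻¹ ≤ ρbar → ρbar ≤ M → ρbar * σ ^ 3 ≤ η₁ → M⁻¹ ≤ θbar → θbar ≤ M → ‖ubar‖ ≤ M →
  ∀ (r κ : ℝ), 0 < r → r ≤ 1 / 4 → 0 ≤ κ → κ * r ≤ ε₀ → ∀ (x₀ : T3),
  ∀ (T : ℝ) (ρ θ : ℝ → T3 → ℝ) (u : ℝ → T3 → V3), IsHardSphereEulerSolution σ T ρ u θ → T ≤ r * s₀ →
    (∀ x, r / 4 ≤ Torus.euclidDist x x₀ → ρ 0 x = ρbar ∧ θ 0 x = θbar ∧ u 0 x = ubar) →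
    ScaleDeviation (ρ 0) ρbar r κ → ScaleDeviation (θ 0) θbar r κ → ScaleDeviationV (u 0) ubar r κ →
  ∀ t ∈ Set.Ico 0 T, ∀ x, |ρ t x - ρbar| ≤ C * κ * r ∧ |θ t x - θbar| ≤ C * κ * r ∧
    ‖u t x - ubar‖ ≤ C * κ * r ∧ ∀ i : Fin 3, |Torus.partialDeriv i (ρ t) x| ≤ C * κ ∧
    ‖Torus.partialDeriv i (u t) x‖ ≤ C * κ ∧ |Torus.partialDeriv i (θ t) x| ≤ C * κ

/-- How the bubble lemma is CONSUMED by the glue (bookkeeping remark, stated as a `Prop` so that it is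
type-checked): the flattened time-zero slice `x ↦ ψ((x-x₀)/r)·f(x) + (1-ψ((x-x₀)/r))·f(x₀)` of a field
with `|∂ᵏf| ≤ M` (`k ≤ 3`) and the DENSITY FLOOR `M⁻¹ ≤ f` is a scale-`r` bubble datum with slope
`κ = C_ψ M` — the floor is what makes the RELATIVE oscillation `≤ C M² r` (see IdeatorTwoNotes §1: without
`M⁻¹ ≤ ρ` in `S` no near-constant comparison gas exists around low-density ripples). -/
def FlattenedSliceIsBubble : Prop :=
  ∀ M : ℝ, 0 < M → ∃ Cψ : ℝ, 0 < Cψ ∧ ∀ (r : ℝ), 0 < r → r ≤ 1 / 4 → ∀ (x₀ : T3) (f : T3 → ℝ),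
    Torus.IsSmooth f → (∀ x, M⁻¹ ≤ f x ∧ f x ≤ M) →
    (∀ x, ∀ i j k : Fin 3, |Torus.partialDeriv i f x| ≤ M ∧
      |Torus.partialDeriv i (Torus.partialDeriv j f) x| ≤ M ∧
      |Torus.partialDeriv i (Torus.partialDeriv j (Torus.partialDeriv k f)) x| ≤ M) →
    ∃ g : T3 → ℝ, Torus.IsSmooth g ∧ (∀ x, Torus.euclidDist x x₀ < r / 8 → g x = f x) ∧
      (∀ x, r / 4 ≤ Torus.euclidDist x x₀ → g x = f x₀) ∧ ScaleDeviation g (f x₀) r (Cψ * M) ∧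
      (∀ x, |g x / f x₀ - 1| ≤ Cψ * M ^ 2 * r)

end

end Summit.AtomisticToContinuum.HydrodynamicLimit.Cruxes.ConeLocalisation.IdeatorTwo
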